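import Mathlib
import Literature.LinearAlgebra.Matrix.CrossProduct
import HarnessLib

/-!
# Degrees of minors of a polynomial matrix; polynomial kernel vectors by Cramer's rule

`Literature/LinearAlgebra/Matrix/PolynomialMinorsDegree.lean`. Everything here is PROVED (no
definition, no named fact); the content is folklore linear algebra. If all entries of a square
matrix `M` over `S[X]` have degree `≤ D`, then `deg det M ≤ n · D`
(`natDegree_det_le_of_forall_le`, Leibniz expansion); consequently the generalized cross product
`cross A` (the vector of signed maximal minors of a `d × (d+1)` matrix `A`,
`Literature.LinearAlgebra.Matrix.cross`, which satisfies `A · cross A = 0` and is nonzero iff the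
rows of `A` are linearly independent) of a polynomial matrix with entries of degree `≤ D` is a
polynomial kernel vector with entries of degree `≤ d · D` (`natDegree_cross_le`,
`exists_polynomial_kernel_vector`). This is the usual "Cramer's rule" device for producing
polynomial (rather than rational) solutions of controlled degree of an underdetermined linear
system over `F(X)`, as used in auxiliary-polynomial constructions of Diophantine approximation
(e.g. E. Bombieri, W. Gubler, *Heights in Diophantine Geometry*, CUP 2006, §2.9, around Siegel's
lemma). It was written while formalizing pieces of F. Calegari, V. Dimitrov, Y. Tang, *The
unbounded denominators conjecture* (J. Amer. Math. Soc. **38** (2025), 627–702), §2, but it is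
NOT a step of the published proof there (whose proof of Lemma 2.0.4 works directly with the exact
vanishing order `β ≥ α` of the auxiliary function); no statement below is attributed to that
paper.

## References

* E. Bombieri, W. Gubler, Heights in Diophantine Geometry, Cambridge Univ. Press 2006, §2.9.
-/

noncomputable section

namespace Literature.LinearAlgebra.Matrix

open _root_.Matrix Polynomial Finset

variable {S : Type*} [CommRing S]

/-- **Degree of the determinant of a polynomial matrix**: if every entry of `M ∈ Matₙ(S[X])` has
degree `≤ D` then `deg det M ≤ n · D` (Leibniz expansion). [folklore] -/
theorem natDegree_det_le_of_forall_le {n : Type*} [Fintype n] [DecidableEq n]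
    (M : Matrix n n S[X]) {D : ℕ} (h : ∀ i j, (M i j).natDegree ≤ D) :
    M.det.natDegree ≤ Fintype.card n * D := by
  rw [Matrix.det_apply]
  refine natDegree_sum_le_of_forall_le _ _ fun σ _ ↦ ?_
  have hprod : (∏ i, M (σ i) i).natDegree ≤ Fintype.card n * D := by
    refine (natDegree_prod_le _ _).trans ?_
    calc ∑ i, (M (σ i) i).natDegree ≤ ∑ _i : n, D := sum_le_sum fun i _ ↦ h (σ i) i
      _ = Fintype.card n * D := by rw [sum_const, smul_eq_mul, Finset.card_univ]
  rcases Int.units_eq_one_or (Equiv.Perm.sign σ) with hσ | hσ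
  · rw [hσ, one_smul]; exact hprod
  · rw [hσ, Units.neg_smul, one_smul, natDegree_neg]; exact hprod

/-- Degrees of maximal minors: for a `d × (d+1)` polynomial matrix with entries of degree `≤ D`,
every entry of the generalized cross product `cross A` (signed maximal minors) has degree
`≤ d · D`. [folklore] -/
theorem natDegree_cross_le {d : ℕ} (A : Matrix (Fin d) (Fin (d + 1)) S[X]) {D : ℕ}
    (h : ∀ i j, (A i j).natDegree ≤ D) (j : Fin (d + 1)) :
    (cross A j).natDegree ≤ d * D := by
  rw [cross_def]
  have hdet : (A.submatrix _root_.id j.succAbove).det.natDegree ≤ d * D := by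
    have h1 := natDegree_det_le_of_forall_le (A.submatrix _root_.id j.succAbove) (D := D)
      (fun i l ↦ h i (j.succAbove l))
    rwa [Fintype.card_fin] at h1
  rcases neg_one_pow_eq_or S[X] (d + (j : ℕ)) with hs | hs
  · rw [hs, one_mul]; exact hdet
  · rw [hs, neg_one_mul, natDegree_neg]; exact hdet

/-- **Polynomial kernel vectors by Cramer's rule**: a `d × (d+1)` matrix `A` over `F[X]` (`F` a
field) with linearly independent rows and entries of degree `≤ D` has a NONZERO kernel vector `Q`
(`A Q = 0`) with polynomial entries of degree `≤ d · D` — namely the vector of signed maximal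
minors. [folklore] -/
theorem exists_polynomial_kernel_vector {F : Type*} [Field F] {d : ℕ}
    (A : Matrix (Fin d) (Fin (d + 1)) F[X]) {D : ℕ} (h : ∀ i j, (A i j).natDegree ≤ D)
    (hA : LinearIndependent (FractionRing F[X]) (fun i ↦ fun j ↦
      algebraMap F[X] (FractionRing F[X]) (A i j))) :
    ∃ Q : Fin (d + 1) → F[X], Q ≠ 0 ∧ A *ᵥ Q = 0 ∧ ∀ j, (Q j).natDegree ≤ d * D := by
  refine ⟨cross A, ?_, mulVec_cross A, natDegree_cross_le A h⟩
  -- nonvanishing: over the fraction field, `cross` of the image matrix is nonzero iff the rows are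
  -- linearly independent, and `cross` commutes with the (injective) ring map
  set K := FractionRing F[X]
  set φ : F[X] →+* K := algebraMap F[X] K
  have hφ : Function.Injective φ := IsFractionRing.injective F[X] K
  have hmap : cross (A.map φ) = fun j ↦ φ (cross A j) := by
    funext j
    rw [cross_def, cross_def, map_mul, map_pow, map_neg, map_one, RingHom.map_det,
      RingHom.mapMatrix_apply]
    rfl
  have hne : cross (A.map φ) ≠ 0 := (cross_ne_zero_iff (A.map φ)).mpr hA
  intro h0
  apply hne
  rw [hmap]
  funext j
  rw [show cross A j = 0 from congrFun h0 j, map_zero, Pi.zero_apply]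

end Literature.LinearAlgebra.Matrix
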